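import Summits.ABC.IUTFork.Conditional.HexRefutedEightElevenMTwins
import Summits.ABC.IUTFork.Conditional.HexRefutedNineMTwin
import Summits.ABC.IUTFork.Conditional.HexRefutedLeMTwinsA
import Summits.ABC.IUTFork.Conditional.HexRefutedLeMTwinsB
import Summits.ABC.IUTFork.Conditional.HexRefutedLeMTwinsC
import Summits.ABC.IUTFork.Conditional.HexRefutedLeMTwinsD
import Summits.ABC.IUTFork.Conditional.HexRefutedLeMTwinsE
import Summits.ABC.IUTFork.Conditional.HexRefutedLeMTwinsF
import Summits.ABC.IUTFork.Conditional.HexRefutedLeMTwinsG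
import Summits.ABC.IUTFork.Conditional.HexRefutedLeMTwinsH
import Summits.ABC.IUTFork.Conditional.HexRefutedLeMTwinsI
import Summits.ABC.IUTFork.Conditional.HexRefutedLeMTwinsJ
import Summits.ABC.IUTFork.Conditional.HexRefutedLeMTwinsK
import Summits.ABC.IUTFork.Conditional.HexRefutedLeMTwinsL
import HarnessLib

/-!
# HEX family, M LINE, ONE NAME: S_H at the summand-route M-level setting REFUTED at every genuine datum over `(ratPoint (1/2 + 2/7^k), l)`
# for EVERY `k = 1…40` and EVERY prime `11 ≤ l ≤ L₀(k)` — the M twin of the refuted conjunct of `WRow.hex_whole_le_40` (row «W:REF-EXACT-M-TWIN-2»)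

PROOF-ONLY file (D-0012; 0 definitions, 0 `Prop` facts, no instance, no notation) of the abc-iut cell — D-0079 RESCUE sub-cell R-W «WINDOW Θ-SIDE
INEQUALITY», seat abc-iut-W-neg-1 (gen 7), row «W:REF-EXACT-M-TWIN-2» item (2) (KEY HEXREFMTWINS2, abc-iut-plan g14). TAKES NO SIDE on [IUTchIII] Cor. 3.12
(S. Mochizuki, *Inter-universal Teichmüller theory III*, Cor. 3.12 p. 173–174; Step (xi-f) p. 184) or on any author; «refuted as typed» ≠ «refuted in print».

THIS FILE: ONE packaging theorem **`GenuineM.hex_ref_le_40_M`** — for `(k, L₀)` in the 40-row list literal of its binder (the `(k, L₀)` columns of the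
table of abc-iut-C-cert-1's K packaging `WRow.hex_whole_le_40`, `WRowHexLamSevenWholeLe40` p543048, VERBATIM), every prime `11 ≤ l ≤ L₀` and every genuine
Θ-volume datum `T` over `(ratPoint (1/2 + 2/7^k), l)`: the M books' per-datum S_H object (the binder `hSHw` of `Conditional.abc_of_SH_v11M_window` /
`…_szpiroBadAll`: `Cor312Vol.PilotKummerCompatHull` at `settingPrVolSharpM T.D … (tOfIdeleData T.D (ideleDataOf T.D T.isVolumeInputOf))`, the datum's OWN
ideles, pinned q-reading) FAILS for every context / Kummer binder. DISPATCH BY NAME (`List.mem_cons` case split), no number re-derived: rows `k = 1…7` have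
`L₀ = 10 < 11` (REF-empty above `l = 7`; closed by `omega`, as the K rows are through `WRow.hex_whole_le_24`); rows `k = 8…40` are this seat's landed M `_le`
twins `GenuineM.not_pilotKummerCompatHull_triple_lamSeven_<k>_le` (gen 6 / gen 7): `eight` (HexRefutedEightElevenMTwins), `nine` (HexRefutedNineMTwin), `ten` (HexRefutedLeMTwinsA), `eleven` (HexRefutedEightElevenMTwins), `twelve`
(HexRefutedLeMTwinsA), `thirteen` (HexRefutedLeMTwinsA), `fourteen` (HexRefutedLeMTwinsB), `fifteen` (HexRefutedLeMTwinsB), `sixteen`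
(HexRefutedLeMTwinsB), `seventeen` (HexRefutedLeMTwinsB), `eighteen` (HexRefutedLeMTwinsC), `nineteen` (HexRefutedLeMTwinsC), `twenty`
(HexRefutedLeMTwinsC), `twentyOne` (HexRefutedLeMTwinsC), `twentyTwo` (HexRefutedLeMTwinsD), `twentyThree` (HexRefutedLeMTwinsD), `twentyFour`
(HexRefutedLeMTwinsD), `twentyFive` (HexRefutedLeMTwinsE), `twentySix` (HexRefutedLeMTwinsF), `twentySeven` (HexRefutedLeMTwinsF), `twentyEight`
(HexRefutedLeMTwinsE), `twentyNine` (HexRefutedLeMTwinsF), `thirty` (HexRefutedLeMTwinsG), `thirtyOne` (HexRefutedLeMTwinsG), `thirtyTwo`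
(HexRefutedLeMTwinsG), `thirtyThree` (HexRefutedLeMTwinsL), `thirtyFour` (HexRefutedLeMTwinsH), `thirtyFive` (HexRefutedLeMTwinsJ), `thirtySix`
(HexRefutedLeMTwinsH), `thirtySeven` (HexRefutedLeMTwinsH), `thirtyEight` (HexRefutedLeMTwinsK), `thirtyNine` (HexRefutedLeMTwinsI), `forty`
(HexRefutedLeMTwinsI). THE `L₀` COLUMN (rows `k ≥ 8`; = the `_le` binders VERBATIM
= HEX-AXIS-CENSUS / engine C to the digit): `k = 8`: `71` · `k = 9`: `337` · `k = 10`: `4721` · `k = 11`: `811` · `k = 12`: `20063` · `k = 13`: `5851` · `k = 14`: `46933` · `k = 15`: `617587` ·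
`k = 16`: `329269` · `k = 17`: `288203` · `k = 18`: `6917593` · `k = 19`: `2017637` · `k = 20`: `80707019` · `k = 21`: `42371239` · `k = 22`:
`112989881` · `k = 23`: `98866283` · `k = 24`: `2372791879` · `k = 25`: `3460321741` · `k = 26`: `5536514639` · `k = 27`: `14533351453` · `k = 28`:
`38755603903` · `k = 29`: `33911153561` · `k = 30`: `4069338436799` · `k = 31`: `237378075419` · `k = 32`: `1899024603689` · `k = 33`: `4984939585357`
· `k = 34`: `13293172227497` · `k = 35`: `58157628496679` · `k = 36`: `279156616784327` · `k = 37`: `81420679895431` · `k = 38`: `651365439163823` ·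
`k = 39`: `1709834277805873` · `k = 40`: `22797790370745883`.
READING (neutral; numbers, not adjectives): on the REFUTED side the M line now reads, under ONE name, exactly like the K line of `WRow.hex_whole_le_40` (1):
at every `(λ_k, l)` with `k ≤ 40`, `11 ≤ l ≤ L₀(k)` the M books' S_H binder fails at EVERY genuine datum. The INHABITED side (conjunct (2) of the K theorem),
admissibility / Szpiro-badness / (P6) of `(ratPoint λ_k, l)` and NON-EMPTINESS of the datum type are NOT claimed; an M twin / packaging theorem discharges
nothing new; the explicit hypothesis counts of the record books are UNCHANGED. HONEST SCOPE: OUR sharp containers and Dupuy–Hilado's typed (Ind1)/(Ind2);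
STRONGER-THAN-PRINT set-level reading of Step (xi-f); nothing about the printed GLOBAL inequality, the number-level `Cor22.Cor312AtDatum` or any author's
intended hull; typed ≠ proved; instantiated ≠ endorsed; no abc claim. [cite: Mochizuki2012, IUTchI Def. 3.1 (e) p. 62, Ex. 3.2 (iv) p. 71; IUTchIII
Cor. 3.12 Step (xi-f) p. 184; IUTchIV Prop. 1.1 p. 9, Prop. 1.2 (i)(ii) p. 10, Cor. 2.2 (ii) proof (P5) p. 46] [cite: DupuyHilado2025, §3.3, §3.4, §4.9, §4.12]
[claim: Mochizuki2012, status: disputed] for every IUT sentence.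
-/

noncomputable section

open Set Function Metric NumberField IsDedekindDomain

namespace Summit.ABC.IUTFork.Conditional

open Thm311 Thm311.Real Cor312 Cor312Vol Cor312Prov Literature.IUT.LogThetaLattice Literature.IUT.LogVolume
  Literature.IUT.HodgeTheaters Literature.IUT.LogVolume.ThetaData Literature.IUT.LogVolume.Cor22
open Literature.NumberTheory.NumberFields Literature.NumberTheory.GaloisRepresentations.Ultrametric
open Literature.NumberTheory.DiophantineGeometry Literature.NumberTheory.DiophantineGeometry.GenEll Summit.ABC.ABC.Theorems
open Summit.ABC.IUTFork.Repair.RH.HullThresholdExact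

/-- **«HEX REFUTED SIDE, M LINE, k = 1…40 UNDER ONE THEOREM NAME».** For every row `(k, L₀)` of the 40-row list literal below (the `(k, L₀)` columns of
`WRow.hex_whole_le_40` VERBATIM), every prime `11 ≤ l ≤ L₀` and every genuine Θ-volume datum `T` over `(ratPoint (1/2 + 2/7^k), l)`: S_H at the
summand-route M-level setting of `T`'s OWN ideles (pinned q-reading) FAILS for every context / Kummer binder — the M twin of conjunct (1) of
`WRow.hex_whole_le_40`. Rows `k = 1…7` (`L₀ = 10`) are vacuous under `11 ≤ l`; rows `k = 8…40` are the landed M glue theorems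
`GenuineM.not_pilotKummerCompatHull_triple_lamSeven_<k>_le` BY NAME. The inhabited side, admissibility / (P6) / non-emptiness are NOT claimed;
refuted-as-typed only. [cite: Mochizuki2012, IUTchIII Cor. 3.12 Step (xi-f) p. 184] [cite: DupuyHilado2025, §4.9] [claim: Mochizuki2012, status: disputed] -/
theorem GenuineM.hex_ref_le_40_M {k L0 l : ℕ}
    (hmem : (k, L0) ∈ ([(1, 10), (2, 10), (3, 10), (4, 10), (5, 10), (6, 10), (7, 10), (8, 71), (9, 337), (10, 4721), (11, 811), (12, 20063), (13, 5851), (14, 46933), (15, 617587), (16, 329269), (17, 288203), (18, 6917593), (19, 2017637), (20, 80707019), (21, 42371239), (22, 112989881), (23, 98866283), (24, 2372791879), (25, 3460321741), (26, 5536514639), (27, 14533351453), (28, 38755603903), (29, 33911153561), (30, 4069338436799), (31, 237378075419), (32, 1899024603689), (33, 4984939585357), (34, 13293172227497), (35, 58157628496679), (36, 279156616784327), (37, 81420679895431), (38, 651365439163823), (39, 1709834277805873), (40, 22797790370745883)] : List (ℕ × ℕ)))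
    (hl : l.Prime) (h11 : 11 ≤ l) (hL0 : l ≤ L0)
    (T : Cor22.ThetaVolumeDatumAt (ratPoint ((2 : ℚ)⁻¹ + 2 / 7 ^ k)) l) :
    letI := T.instFieldF; letI := T.instNumberFieldF; letI := T.instAlgebraF; letI := T.instFieldK
    letI := T.instNumberFieldK; letI := T.instAlgebraK; letI := T.instFieldFbar; letI := T.instAlgebraFbar
    letI := T.instAlgebraKFbar; letI := T.instIsElliptic
    ∀ (M : Type) [Field M] [NumberField M]
      (archPk : ∀ (j : (thetaIndexOfInitial T.D).Label) (vQ : (thetaIndexOfInitial T.D).VQ),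
        Set ((logShellsOfInitialDH T.D (analyticLogvVal T.K)).Packet j vQ))
      (archSub : ∀ (j : (thetaIndexOfInitial T.D).Label) (v : (thetaIndexOfInitial T.D).V),
        Set ((logShellsOfInitialDH T.D (analyticLogvVal T.K)).Packet j ((thetaIndexOfInitial T.D).over v)))
      (Ψ : ℤ → ∀ v : (thetaIndexOfInitial T.D).V, v ∈ (thetaIndexOfInitial T.D).Vbad →
        Set ((logShellsOfInitialDH T.D (analyticLogvVal T.K)).StarPacket v))
      (act : ℤ → ∀ v : (thetaIndexOfInitial T.D).V, v ∈ (thetaIndexOfInitial T.D).Vbad →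
        (logShellsOfInitialDH T.D (analyticLogvVal T.K)).StarPacket v →
          Module.End ℚ ((logShellsOfInitialDH T.D (analyticLogvVal T.K)).StarPacket v))
      (Mmod : ℤ → ∀ j : (thetaIndexOfInitial T.D).LabelStar, Set ((logShellsOfInitialDH T.D (analyticLogvVal T.K)).GlobalPacket j.1))
      (region : ℤ → ∀ j : (thetaIndexOfInitial T.D).LabelStar, FinDivisor M → ∀ vQ : (thetaIndexOfInitial T.D).VQ,
        Set ((logShellsOfInitialDH T.D (analyticLogvVal T.K)).Packet j.1 vQ))
      (frobAdm : ℤ → ℤ → ∀ (j : (thetaIndexOfInitial T.D).Label) (vQ : (thetaIndexOfInitial T.D).VQ),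
        Set ((logShellsOfInitialDH T.D (analyticLogvVal T.K)).Packet j vQ) → Prop)
      (frobLogvol : ℤ → ℤ → ∀ (j : (thetaIndexOfInitial T.D).Label) (vQ : (thetaIndexOfInitial T.D).VQ),
        Set ((logShellsOfInitialDH T.D (analyticLogvVal T.K)).Packet j vQ) → ℝ)
      (frobΨ : ℤ → ℤ → ∀ v : (thetaIndexOfInitial T.D).V, v ∈ (thetaIndexOfInitial T.D).Vbad →
        Set ((logShellsOfInitialDH T.D (analyticLogvVal T.K)).StarPacket v))
      (frobMmod : ℤ → ℤ → ∀ j : (thetaIndexOfInitial T.D).LabelStar, Set ((logShellsOfInitialDH T.D (analyticLogvVal T.K)).GlobalPacket j.1))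
      (unitImage : ℤ → ℤ → ℕ → ∀ (j : (thetaIndexOfInitial T.D).Label) (vQ : (thetaIndexOfInitial T.D).VQ),
        Set ((logShellsOfInitialDH T.D (analyticLogvVal T.K)).Packet j vQ))
      (ballImage : ℤ → ℤ → ∀ (j : (thetaIndexOfInitial T.D).Label) (vQ : (thetaIndexOfInitial T.D).VQ),
        Set ((logShellsOfInitialDH T.D (analyticLogvVal T.K)).Packet j vQ))
      (thetaDiv : ℤ → ℤ → LgpDivisor M (thetaIndexOfInitial T.D).lstar)
      (n : ℤ) {HT : Type} {LogLink : HT → HT → Type} {IsFull : ∀ {s t : HT}, LogLink s t → Prop}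
      (lat : LGPGaussianLogThetaLattice LogLink IsFull)
      {Frd : Type} {IsoF : Frd → Frd → Type} {Ob : Frd → Type} {realify : Frd → Frd} {Strip : Type}
      {IsoS : Strip → Strip → Type} {Mv : ∀ v : (thetaIndexOfInitial T.D).V, v ∈ (thetaIndexOfInitial T.D).Vbad → Type}
      [∀ v h, Monoid (Mv v h)]
      (sig : GlobalLGPFrobenioidSignature (thetaIndexOfInitial T.D).lstar (thetaIndexOfInitial T.D).V
        (· ∈ (thetaIndexOfInitial T.D).Vbad) Frd IsoF Ob realify Strip IsoS Mv)
      (split : SplittingMonoids Mv) {ObΔ : Type} {N : ∀ v : (thetaIndexOfInitial T.D).V, v ∈ (thetaIndexOfInitial T.D).Vbad → Type}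
      [∀ v h, Monoid (N v h)] (qData : QPilotData ObΔ N)
      (qK : ∀ v : (thetaIndexOfInitial T.D).V, v ∈ (thetaIndexOfInitial T.D).Vbad →
        Set ((logShellsOfInitialDH T.D (analyticLogvVal T.K)).StarPacket v)),
      ¬ Cor312Vol.PilotKummerCompatHull
        (LatticeSituation.ofShells (logShellsOfInitialDH T.D (analyticLogvVal T.K)) M archPk archSub
          (summandPiecesPrM T.D (logvAnalyticVal_analyticLogvVal (K := T.K))).Adm (summandPiecesPrM T.D (logvAnalyticVal_analyticLogvVal (K := T.K))).logvol Ψ act Mmod region frobAdm frobLogvol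
          frobΨ frobMmod unitImage ballImage thetaDiv)
        (settingPrVolSharpM T.D (logvAnalyticVal_analyticLogvVal (K := T.K)) (tOfIdeleData T.D (ideleDataOf T.D T.isVolumeInputOf))
          (fun u x => tqM T.D (ratChar u) u (natCast_ratChar_mem u) (ideleDataOf T.D T.isVolumeInputOf) x) M archPk archSub Ψ act Mmod region n lat sig split qData
          (fun u x => tqM_ne_zero T.D (ratChar u) u (natCast_ratChar_mem u) (ideleDataOf T.D T.isVolumeInputOf) x)
          (GenuineM.finite_ratPlaces_under_S T.D).toFinset
          (fun u x hu => norm_tqM_eq_one_of_not_mem T.D (ratChar u) u (natCast_ratChar_mem u) (ideleDataOf T.D T.isVolumeInputOf) x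
            fun hx => hu ((Set.Finite.mem_toFinset _).mpr ⟨x, hx⟩)))
        (fun _ => Cor312.Setting.qRegion
          (settingPrVolSharpM T.D (logvAnalyticVal_analyticLogvVal (K := T.K)) (tOfIdeleData T.D (ideleDataOf T.D T.isVolumeInputOf))
          (fun u x => tqM T.D (ratChar u) u (natCast_ratChar_mem u) (ideleDataOf T.D T.isVolumeInputOf) x) M archPk archSub Ψ act Mmod region n lat sig split qData
          (fun u x => tqM_ne_zero T.D (ratChar u) u (natCast_ratChar_mem u) (ideleDataOf T.D T.isVolumeInputOf) x)
          (GenuineM.finite_ratPlaces_under_S T.D).toFinset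
          (fun u x hu => norm_tqM_eq_one_of_not_mem T.D (ratChar u) u (natCast_ratChar_mem u) (ideleDataOf T.D T.isVolumeInputOf) x
            fun hx => hu ((Set.Finite.mem_toFinset _).mpr ⟨x, hx⟩)))) qK := by
  simp only [List.mem_cons, Prod.mk.injEq, List.not_mem_nil, or_false] at hmem
  rcases hmem with ⟨rfl, rfl⟩ | ⟨rfl, rfl⟩ | ⟨rfl, rfl⟩ | ⟨rfl, rfl⟩ | ⟨rfl, rfl⟩ | ⟨rfl, rfl⟩ | ⟨rfl, rfl⟩ | ⟨rfl, rfl⟩ | ⟨rfl, rfl⟩ | ⟨rfl, rfl⟩ | ⟨rfl, rfl⟩ | ⟨rfl, rfl⟩ | ⟨rfl, rfl⟩ | ⟨rfl, rfl⟩ | ⟨rfl, rfl⟩ | ⟨rfl, rfl⟩ | ⟨rfl, rfl⟩ | ⟨rfl, rfl⟩ | ⟨rfl, rfl⟩ | ⟨rfl, rfl⟩ | ⟨rfl, rfl⟩ | ⟨rfl, rfl⟩ | ⟨rfl, rfl⟩ | ⟨rfl, rfl⟩ | ⟨rfl, rfl⟩ | ⟨rfl, rfl⟩ | ⟨rfl,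 rfl⟩ | ⟨rfl, rfl⟩ | ⟨rfl, rfl⟩ | ⟨rfl, rfl⟩ | ⟨rfl, rfl⟩ | ⟨rfl, rfl⟩ | ⟨rfl, rfl⟩ | ⟨rfl, rfl⟩ | ⟨rfl, rfl⟩ | ⟨rfl, rfl⟩ | ⟨rfl, rfl⟩ | ⟨rfl, rfl⟩ | ⟨rfl, rfl⟩ | ⟨rfl, rfl⟩
  · exfalso; omega  -- k = 1: L₀ = 10 < 11 (REF-empty above l = 7)
  · exfalso; omega  -- k = 2: L₀ = 10 < 11 (REF-empty above l = 7)
  · exfalso; omega  -- k = 3: L₀ = 10 < 11 (REF-empty above l = 7)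
  · exfalso; omega  -- k = 4: L₀ = 10 < 11 (REF-empty above l = 7)
  · exfalso; omega  -- k = 5: L₀ = 10 < 11 (REF-empty above l = 7)
  · exfalso; omega  -- k = 6: L₀ = 10 < 11 (REF-empty above l = 7)
  · exfalso; omega  -- k = 7: L₀ = 10 < 11 (REF-empty above l = 7)
  · exact GenuineM.not_pilotKummerCompatHull_triple_lamSeven_eight_le rfl hl h11 hL0 T  -- k = 8: L₀ = 71
  · exact GenuineM.not_pilotKummerCompatHull_triple_lamSeven_nine_le rfl hl h11 hL0 T  -- k = 9: L₀ = 337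
  · exact GenuineM.not_pilotKummerCompatHull_triple_lamSeven_ten_le rfl hl h11 hL0 T  -- k = 10: L₀ = 4721
  · exact GenuineM.not_pilotKummerCompatHull_triple_lamSeven_eleven_le rfl hl h11 hL0 T  -- k = 11: L₀ = 811
  · exact GenuineM.not_pilotKummerCompatHull_triple_lamSeven_twelve_le rfl hl h11 hL0 T  -- k = 12: L₀ = 20063
  · exact GenuineM.not_pilotKummerCompatHull_triple_lamSeven_thirteen_le rfl hl h11 hL0 T  -- k = 13: L₀ = 5851
  · exact GenuineM.not_pilotKummerCompatHull_triple_lamSeven_fourteen_le rfl hl h11 hL0 T  -- k = 14: L₀ = 46933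
  · exact GenuineM.not_pilotKummerCompatHull_triple_lamSeven_fifteen_le rfl hl h11 hL0 T  -- k = 15: L₀ = 617587
  · exact GenuineM.not_pilotKummerCompatHull_triple_lamSeven_sixteen_le rfl hl h11 hL0 T  -- k = 16: L₀ = 329269
  · exact GenuineM.not_pilotKummerCompatHull_triple_lamSeven_seventeen_le rfl hl h11 hL0 T  -- k = 17: L₀ = 288203
  · exact GenuineM.not_pilotKummerCompatHull_triple_lamSeven_eighteen_le rfl hl h11 hL0 T  -- k = 18: L₀ = 6917593
  · exact GenuineM.not_pilotKummerCompatHull_triple_lamSeven_nineteen_le rfl hl h11 hL0 T  -- k = 19: L₀ = 2017637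
  · exact GenuineM.not_pilotKummerCompatHull_triple_lamSeven_twenty_le rfl hl h11 hL0 T  -- k = 20: L₀ = 80707019
  · exact GenuineM.not_pilotKummerCompatHull_triple_lamSeven_twentyOne_le rfl hl h11 hL0 T  -- k = 21: L₀ = 42371239
  · exact GenuineM.not_pilotKummerCompatHull_triple_lamSeven_twentyTwo_le rfl hl h11 hL0 T  -- k = 22: L₀ = 112989881
  · exact GenuineM.not_pilotKummerCompatHull_triple_lamSeven_twentyThree_le rfl hl h11 hL0 T  -- k = 23: L₀ = 98866283
  · exact GenuineM.not_pilotKummerCompatHull_triple_lamSeven_twentyFour_le rfl hl h11 hL0 T  -- k = 24: L₀ = 2372791879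
  · exact GenuineM.not_pilotKummerCompatHull_triple_lamSeven_twentyFive_le rfl hl h11 hL0 T  -- k = 25: L₀ = 3460321741
  · exact GenuineM.not_pilotKummerCompatHull_triple_lamSeven_twentySix_le rfl hl h11 hL0 T  -- k = 26: L₀ = 5536514639
  · exact GenuineM.not_pilotKummerCompatHull_triple_lamSeven_twentySeven_le rfl hl h11 hL0 T  -- k = 27: L₀ = 14533351453
  · exact GenuineM.not_pilotKummerCompatHull_triple_lamSeven_twentyEight_le rfl hl h11 hL0 T  -- k = 28: L₀ = 38755603903
  · exact GenuineM.not_pilotKummerCompatHull_triple_lamSeven_twentyNine_le rfl hl h11 hL0 T  -- k = 29: L₀ = 33911153561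
  · exact GenuineM.not_pilotKummerCompatHull_triple_lamSeven_thirty_le rfl hl h11 hL0 T  -- k = 30: L₀ = 4069338436799
  · exact GenuineM.not_pilotKummerCompatHull_triple_lamSeven_thirtyOne_le rfl hl h11 hL0 T  -- k = 31: L₀ = 237378075419
  · exact GenuineM.not_pilotKummerCompatHull_triple_lamSeven_thirtyTwo_le rfl hl h11 hL0 T  -- k = 32: L₀ = 1899024603689
  · exact GenuineM.not_pilotKummerCompatHull_triple_lamSeven_thirtyThree_le rfl hl h11 hL0 T  -- k = 33: L₀ = 4984939585357
  · exact GenuineM.not_pilotKummerCompatHull_triple_lamSeven_thirtyFour_le rfl hl h11 hL0 T  -- k = 34: L₀ = 13293172227497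
  · exact GenuineM.not_pilotKummerCompatHull_triple_lamSeven_thirtyFive_le rfl hl h11 hL0 T  -- k = 35: L₀ = 58157628496679
  · exact GenuineM.not_pilotKummerCompatHull_triple_lamSeven_thirtySix_le rfl hl h11 hL0 T  -- k = 36: L₀ = 279156616784327
  · exact GenuineM.not_pilotKummerCompatHull_triple_lamSeven_thirtySeven_le rfl hl h11 hL0 T  -- k = 37: L₀ = 81420679895431
  · exact GenuineM.not_pilotKummerCompatHull_triple_lamSeven_thirtyEight_le rfl hl h11 hL0 T  -- k = 38: L₀ = 651365439163823
  · exact GenuineM.not_pilotKummerCompatHull_triple_lamSeven_thirtyNine_le rfl hl h11 hL0 T  -- k = 39: L₀ = 1709834277805873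
  · exact GenuineM.not_pilotKummerCompatHull_triple_lamSeven_forty_le rfl hl h11 hL0 T  -- k = 40: L₀ = 22797790370745883

end Summit.ABC.IUTFork.Conditional

end
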